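import Summits.KontsevichZagierPeriods.Zeta5Search.Barrier.ConeGammaS7Gamma

/-!
# ζ(5) search — BARRIER: the `S₇` REDUCTION of the barrier statement to the SORTED chamber — conditional form

HONEST FRAMING (cell `pub-zeta5`): systematic search; no irrationality claim unless kernel-certified. MODEL objects
under Brown–Zudilin's (28)+(30) accounting ([BZ22] = arXiv:2210.03391; (28) observed, not proved); nothing here is a
statement about `ζ(5)`; C2 = `BarrierC2` stays OPEN and no bound on the cone is claimed. No number or sentence of
record moves. Records in print UNMOVED. Prover P2 g20 (second self-selected Lean-only item, file 4).

`ConeGammaRates.coneSupBound_iff_height_one`'s docstring reduces the barrier statement «to the ordered simplex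
`0 ≤ t₁ ≤ … ≤ t₇ ≤ 1` after the `S₇` reduction»; every census fold and every branch-and-bound design of the cell works
on that chamber. In the kernel, that reduction needs `γ(g·a) = γ(a)`, and by `ConeGammaS7Gamma` (δ₂₈ a class
function, `Φ` carrying the F-entropy cocycle) this is EXACTLY the statement that the critical values carry the same
cocycle. This file makes the reduction a theorem CONDITIONAL on that one algebraic hypothesis, stated for the
critical SET:

* `BZCone_permAct` — the cone is `S₇`-invariant; `exists_permAct_sorted` — every direction has a sorted
  representative (`Tuple.sort`);
* `regular_of_critVals_eq_image`, `C1_of_critVals_eq_image`, `C0_of_critVals_eq_image` — if `critVals b` is the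
  translate of `critVals a` by `E` and `a` is Regular, then `b` is Regular and `C₁, C₀` shift by `E`;
* **`coneSupBound_iff_sorted_of_critShift`** — IF for every `a` in the cone and every `g ∈ S₇`,
  `critVals (g·a) = critVals a + ΔE(g; a)` with `ΔE(g; a) = Σ_{i∈F}[h_i(ga) log h_i(ga) − h_i(a) log h_i(a)]`
  (HYPOTHESIS — the hypergeometric-group symmetry of BZ's §5 critical values; proved for NO direction in the kernel;
  seat numerics at the record direction to 1e−8), THEN for every `γ*`:
  `ConeSupBound γ* ↔ (∀ a ∈ BZCone, s₁(a) ≤ … ≤ s₇(a) → Regular a → γ(a) ≤ γ*)`.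
NOT here: the hypothesis itself, any value of `γ`, C2, S-E, `ζ(5)`.
-/

noncomputable section

open Set

namespace Summit.KontsevichZagierPeriods.Zeta5Search.Barrier.ConeGamma

/-! ### The cone and the sorted chamber under `S₇` -/

/-- The parameters of `g·a` are `s_{g(j)}(a)`. -/
theorem sParam_permAct_succ (g : Equiv.Perm (Fin 7)) (a : Dir) (j : Fin 7) :
    sParam (permAct g a) j.succ = sParam a (g j).succ := by
  rw [sParam_permAct, permS_apply, liftPerm_succ]

/-- **The BZ cone is `S₇`-invariant.** -/
theorem BZCone_permAct {a : Dir} (ha : a ∈ BZCone) (g : Equiv.Perm (Fin 7)) : permAct g a ∈ BZCone := by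
  refine ⟨BZBox_permAct ha.1 g, ?_⟩
  have hsum : ∑ j : Fin 7, sParam (permAct g a) j.succ = ∑ j : Fin 7, sParam a j.succ := by
    simp only [sParam_permAct_succ]
    exact Equiv.sum_comp g (fun j => sParam a j.succ)
  rw [sParam_permAct_zero, hsum]
  exact ha.2

/-- **Every direction has a sorted representative**: some `g ∈ S₇` makes `j ↦ s_j(g·a)` monotone. -/
theorem exists_permAct_sorted (a : Dir) :
    ∃ g : Equiv.Perm (Fin 7), Monotone fun j : Fin 7 => sParam (permAct g a) j.succ := by
  refine ⟨Tuple.sort fun j : Fin 7 => sParam a j.succ, ?_⟩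
  have h := Tuple.monotone_sort fun j : Fin 7 => sParam a j.succ
  have hfun : (fun j : Fin 7 => sParam (permAct (Tuple.sort fun j : Fin 7 => sParam a j.succ) a) j.succ)
      = (fun j : Fin 7 => sParam a j.succ) ∘ Tuple.sort fun j : Fin 7 => sParam a j.succ := by
    funext j
    simp only [Function.comp_apply, sParam_permAct_succ]
  rw [hfun]
  exact h

/-! ### Critical values translated by a constant -/

/-- A translate of a Regular critical set is Regular. -/
theorem regular_of_critVals_eq_image {a b : Dir} {E : ℝ} (hreg : Regular a)
    (h : critVals b = (fun v => v + E) '' critVals a) : Regular b := by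
  unfold Regular at *
  rw [h, Set.ncard_image_of_injective _ (add_left_injective E), hreg]

/-- `C₁` of a translated Regular critical set. -/
theorem C1_of_critVals_eq_image {a b : Dir} {E : ℝ} (hreg : Regular a)
    (h : critVals b = (fun v => v + E) '' critVals a) : C1 b = C1 a + E := by
  unfold Regular at hreg
  have hfin : (critVals a).Finite := Set.finite_of_ncard_ne_zero (by omega)
  have hne : (critVals a).Nonempty := Set.nonempty_of_ncard_ne_zero (by omega)
  unfold C1
  rw [h]
  have hmap := (OrderIso.addRight E).map_csSup' hne hfin.bddAbove
  have himg : (OrderIso.addRight E) '' critVals a = (fun v => v + E) '' critVals a := by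
    ext v; simp
  rw [himg] at hmap
  rw [← hmap]
  simp

/-- `C₀` of a translated Regular critical set. -/
theorem C0_of_critVals_eq_image {a b : Dir} {E : ℝ} (hreg : Regular a)
    (h : critVals b = (fun v => v + E) '' critVals a) : C0 b = C0 a + E := by
  have hC1 := C1_of_critVals_eq_image hreg h
  unfold Regular at hreg
  have hfin : (critVals a).Finite := Set.finite_of_ncard_ne_zero (by omega)
  have hlt : 1 < (critVals a).ncard := by omega
  obtain ⟨x, hx, y, hy, hxy⟩ := (Set.one_lt_ncard hfin).mp hlt
  have hne : (critVals a \ {C1 a}).Nonempty := by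
    by_cases hxc : x = C1 a
    · exact ⟨y, hy, fun hy' => hxy (hxc.trans (Set.mem_singleton_iff.mp hy').symm)⟩
    · exact ⟨x, hx, fun hx' => hxc (Set.mem_singleton_iff.mp hx')⟩
  have hfin' : (critVals a \ {C1 a}).Finite := hfin.subset Set.sdiff_subset
  unfold C0
  rw [hC1, h, show ({C1 a + E} : Set ℝ) = (fun v => v + E) '' {C1 a} by rw [Set.image_singleton],
    ← Set.image_sdiff (add_left_injective E)]
  have hmap := (OrderIso.addRight E).map_csSup' hne hfin'.bddAbove
  have himg : (OrderIso.addRight E) '' (critVals a \ {C1 a}) = (fun v => v + E) '' (critVals a \ {C1 a}) := by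
    ext v; simp
  rw [himg] at hmap
  rw [← hmap]
  simp

/-! ### The reduction -/

/-- **The `S₇` reduction of the barrier statement, conditional on the critical-value cocycle.** IF for every `a` in
the cone and every `g ∈ S₇` the critical set of `g·a` is the critical set of `a` translated by the F-entropy cocycle
`ΔE(g; a) = Σ_{i∈F}[h_i(ga)·log h_i(ga) − h_i(a)·log h_i(a)]` (HYPOTHESIS, proved for no direction in the kernel),
THEN `ConeSupBound γ*` holds iff it holds on the SORTED chamber `s₁ ≤ s₂ ≤ … ≤ s₇` of the cone. -/
theorem coneSupBound_iff_sorted_of_critShift (γs : ℝ)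
    (hcrit : ∀ a ∈ BZCone, ∀ g : Equiv.Perm (Fin 7), critVals (permAct g a)
      = (fun v => v + ∑ i ∈ FIdx, (h28 (permAct g a) i * Real.log (h28 (permAct g a) i)
          - h28 a i * Real.log (h28 a i))) '' critVals a) :
    ConeSupBound γs ↔
      ∀ a ∈ BZCone, Monotone (fun j : Fin 7 => sParam a j.succ) → Regular a → gamma a ≤ γs := by
  constructor
  · exact fun h a ha _ hr => h a ha hr
  · intro h a ha hr
    obtain ⟨g, hg⟩ := exists_permAct_sorted a
    have hcv := hcrit a ha g
    have hC1 := C1_of_critVals_eq_image hr hcv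
    have hC0 := C0_of_critVals_eq_image hr hcv
    have hreg' : Regular (permAct g a) := regular_of_critVals_eq_image hr hcv
    have hle := h (permAct g a) (BZCone_permAct ha g) hg hreg'
    rwa [gamma_permAct_of_critShift ha.1 g hC1 hC0] at hle

end Summit.KontsevichZagierPeriods.Zeta5Search.Barrier.ConeGamma

end
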